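import Summits.HodgeConjecture.HodgeConjecture.Theses.LinearSystemTorelli
import Literature.AlgebraicGeometry.HodgeTheory.MiddleDimensionReductionOfHodgeModels
import Literature.AlgebraicGeometry.HodgeTheory.MiddleDimensionReductionHolds
import Literature.AlgebraicGeometry.HodgeTheory.HypersurfaceSectionLefschetz
import Literature.AlgebraicGeometry.HodgeTheory.SupportedClassesHodgeConiveau
import Literature.AlgebraicGeometry.HodgeTheory.AlgebraicClassesCup
import Literature.AlgebraicGeometry.HodgeTheory.AmbientClassesMoving
import Literature.AlgebraicGeometry.HodgeTheory.HypersurfaceLefschetzUpper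
import Literature.AlgebraicGeometry.HodgeTheory.GysinBaseChange
import Literature.AlgebraicGeometry.HodgeTheory.ComplexGysinRational
import Literature.AlgebraicGeometry.HodgeTheory.RationalClassesRingChange
import Literature.AlgebraicGeometry.HodgeTheory.GysinHodgeClassLiftProofs
import Literature.AlgebraicGeometry.Motives.UniversalHyperplaneSection
import Literature.AlgebraicGeometry.Motives.ProjectiveSpaceFieldPointsBijective
import Literature.AlgebraicGeometry.Motives.ComplexPointsOpenDense
import Literature.AlgebraicGeometry.Motives.VarietiesGeometricallyIntegralProofs
import Literature.Topology.FourManifolds.ComplexProjectiveSpaceHomologyProofs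
import Summits.HodgeConjecture.HodgeConjecture.Theorems.PadicSemiregularLiftHodgeBeyondAnchorsProductsNotAnchors

/-!
# Route LinearSystemTorelli — `PencilReduction` (item stmt-HodgeConjecture-1083): rational classes and Hodge types

Helper file of the conditional assembly `LinearSystemTorelliPencilReduction`: algebraic classes are of type
`(p, p)` granted Grothendieck's Hodge-coniveau inclusion (the tree's named fact
`Grothendieck1969_supportedClasses_le_hodgeConiveau`); Gysin morphisms send rational classes to a fixed
non-zero multiple of rational classes; rational descent along an injective map preserving rationality (the
tree's `IsRationalClass.of_apply_of_injective` with an arbitrary target space); and an injective pull-back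
between smooth projective varieties reflects Hodge types (directness of the Hodge decomposition).
Everything is proved.
-/

noncomputable section

open scoped Manifold ContDiff
open CategoryTheory CategoryTheory.Limits AlgebraicGeometry MonoidalCategory CartesianMonoidalCategory
open Literature.AlgebraicTopology.SingularHomology
open Literature.AlgebraicGeometry Literature.AlgebraicGeometry.Motives Literature.AlgebraicGeometry.HodgeTheory

set_option linter.dupNamespace false

namespace Summit.HodgeConjecture.HodgeConjecture.Theorems

/-! ### Rational classes and Hodge types: bookkeeping -/

/-- **Algebraic classes are of Hodge type `(p, p)`**, granted Grothendieck's `Nᵖ H²ᵖ ⊆` (Hodge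
coniveau `≥ p`): in degree `2p` the only `(a, b)` with `a + b = 2p`, `a, b ≥ p` is `(p, p)`.
[cite: GrothendieckTopology1969, pp. 299–300] [cite: VoisinHodgeI2002, Prop. 11.20] -/
theorem isOfHodgeType_of_mem_algebraicClasses (hG : Grothendieck1969_supportedClasses_le_hodgeConiveau)
    {n p : ℕ} {Y : SchemeOver ℂ} (hY : IsSmoothProjective n Y) (A : HodgeModel n Y) {c : complexBetti Y (2 * p)}
    (hc : c ∈ algebraicClasses Y p) : IsOfHodgeType n Y (2 * p) p p c := by
  refine ⟨A, ?_⟩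
  have h := Grothendieck1969_supportedClasses_le_hodgeConiveau.pullback_mem_hodgeConiveau hG hY A hc
  refine (?_ : A.hodgeConiveau (2 * p) p ≤ A.hodgePQ (2 * p) p p) h
  refine iSup_le fun a ↦ iSup_le fun b ↦ iSup_le fun hab ↦ iSup_le fun ha ↦ iSup_le fun hb ↦ ?_
  have h1 : a = p := by omega
  have h2 : b = p := by omega
  rw [h1, h2]

/-- **Gysin morphisms map rational classes to a fixed non-zero multiple of rational classes**
(`complexGysin μ` is `u •` the rational Gysin morphism on rational classes, `u ≠ 0`:
`complexGysin_ringChange_eq_smul_gysinMap`; in degrees above `2 dim Y` it vanishes).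
[cite: VoisinHodgeI2002, §7.3.2] [cite: FultonYoungTableaux1997, Appendix B §B.1 (5)] -/
theorem exists_smul_isRationalClass_complexGysin (μ : OrientationFamily) {m n : ℕ} {Y X : SchemeOver ℂ}
    (hY : IsSmoothProjective m Y) (hX : IsSmoothProjective n X) (f : Y ⟶ X) {a b : ℕ}
    (hab : a + 2 * n = b + 2 * m) :
    ∃ u : ℂ, u ≠ 0 ∧ ∀ y : complexBetti Y a, IsRationalClass y →
      ∃ r : complexBetti X b, IsRationalClass r ∧ complexGysin μ hY hX f hab y = u • r := by
  by_cases ha : a ≤ 2 * m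
  · have hμ : μ.HasPoincareDuality := OrientationFamily.hasPoincareDuality μ
    obtain ⟨νY⟩ := Motives.ComplexPoints.isOrientableOver ℚ hY
    obtain ⟨νX, hνX⟩ := exists_ratOrientation_hasPoincareDuality hX
    obtain ⟨u, hu0, hu⟩ := complexGysin_ringChange_eq_smul_gysinMap hμ hY hX f (a := a) (b := b) (q := 2 * m - a)
      (by omega) (by omega) νY νX hνX
    refine ⟨u, hu0, fun y hy ↦ ?_⟩
    obtain ⟨y₀, rfl⟩ := IsRationalClass.exists_ringChange_eq hy
    exact ⟨_, isRationalClass_ringChange _, hu y₀⟩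
  · refine ⟨1, one_ne_zero, fun y _ ↦ ⟨0, IsRationalClass.zero, ?_⟩⟩
    rw [complexGysin_of_lt hY hX f hab (not_le.1 ha), LinearMap.zero_apply, smul_zero]

/-- **Rational descent along an injective map preserving rational classes, between two spaces**
(the tree's `IsRationalClass.of_apply_of_injective` with an arbitrary target space; same proof:
complexify a `ℚ`-basis of `Hᵏ(X(ℂ); ℚ)`). [cite: VoisinHodgeI2002, §7.1.1 and §7.1.2]
[cite: HatcherAT2002, §3.1 Thm. 3.2 and p. 198] -/
theorem IsRationalClass.of_apply_of_injective' {n k m : ℕ} {X : SchemeOver ℂ} (hX : IsSmoothProjective n X)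
    {T : Type} [TopologicalSpace T] (f : complexBetti X k →ₗ[ℂ] singularCohomology ℂ ℂ T m)
    (hf : Function.Injective f) (hfQ : ∀ c : complexBetti X k, IsRationalClass c → IsRationalClass (f c))
    {c : complexBetti X k} (hc : IsRationalClass (f c)) : IsRationalClass c := by
  classical
  haveI := finite_singularCohomology_rat_complexPoints hX k
  set b := Module.finBasis ℚ (singularCohomology ℚ ℚ (ComplexPoints X) k) with hb
  set v : Fin (Module.finrank ℚ (singularCohomology ℚ ℚ (ComplexPoints X) k)) → complexBetti X k :=
    fun i ↦ singularCohomology.ringChange (algebraMap ℚ ℂ) (ComplexPoints X) k (b i) with hv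
  have hv_span : (⊤ : Submodule ℂ (complexBetti X k)) ≤ Submodule.span ℂ (Set.range v) := by
    rw [← span_isRationalClass_eq_top_of_isSmoothProjective_holds n X hX k, Submodule.span_le]
    intro c' hc'
    obtain ⟨x, rfl⟩ := IsRationalClass.exists_ringChange_eq hc'
    have hx : x ∈ Submodule.span ℚ (Set.range b) := by
      rw [b.span_eq]
      exact Submodule.mem_top
    have h1 := ringChange_mem_span_image_of_mem_span hx
    rwa [← Set.range_comp] at h1
  have hw : ∀ i, ∃ y : singularCohomology ℚ ℚ T m,
      singularCohomology.ringChange (algebraMap ℚ ℂ) T m y = f (v i) :=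
    fun i ↦ IsRationalClass.exists_ringChange_eq (hfQ _ (isRationalClass_ringChange (b i)))
  choose y hy using hw
  obtain ⟨z, hz⟩ := IsRationalClass.exists_ringChange_eq hc
  have hfc_mem : f c ∈ Submodule.span ℂ (Set.range fun i ↦ f (v i)) := by
    have h1 : f c ∈ (Submodule.span ℂ (Set.range v)).map f :=
      Submodule.mem_map_of_mem (hv_span Submodule.mem_top)
    rwa [Submodule.map_span, ← Set.range_comp] at h1
  have hz_mem : z ∈ Submodule.span ℚ (Set.range y) := by
    rw [← ringChange_mem_span_image_iff (Submodule.span ℚ (Set.range y)) z, hz]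
    refine Submodule.span_mono ?_ hfc_mem
    rintro _ ⟨i, rfl⟩
    exact ⟨y i, Submodule.subset_span ⟨i, rfl⟩, hy i⟩
  obtain ⟨q, hq⟩ := Submodule.mem_span_range_iff_exists_fun ℚ |>.1 hz_mem
  have hfc : f c = f (singularCohomology.ringChange (algebraMap ℚ ℂ) (ComplexPoints X) k
      (∑ i, q i • b i)) := by
    rw [← hz, ← hq, ringChange_sum_smul, ringChange_sum_smul, map_sum]
    refine Finset.sum_congr rfl fun i _ ↦ ?_
    rw [map_smul, hy i]
  rw [hf hfc]
  exact isRationalClass_ringChange _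

/-- **An injective pull-back reflects Hodge types**: if `f^* : Hᵏ(X(ℂ)) → Hᵏ(Y(ℂ))` is injective
(`f : Y → X` a morphism of smooth projective varieties) and `f^* x` is of type `(p, q)`, so is `x` —
decompose `x = Σ x^{a,b}`; the `f^* x^{a,b}` are of type `(a, b)` (`f^*` is a morphism of Hodge
structures) and sum to a class of type `(p, q)`, so by the directness of the Hodge decomposition of
`Y` the components with `(a, b) ≠ (p, q)` vanish, hence so do the `x^{a,b}` by injectivity.
[cite: VoisinHodgeI2002, §7.1.1 and §7.3.2] -/
theorem IsOfHodgeType.of_map_of_injective (hI : hodgePQ_independent_of_hodgeModel) {d n k p q : ℕ}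
    {Y X : SchemeOver ℂ} (hY : IsSmoothProjective d Y) (hX : IsSmoothProjective n X) (B : HodgeModel d Y)
    (A : HodgeModel n X) (f : Y ⟶ X) (hf : Function.Injective (complexBetti.map f k))
    {x : complexBetti X k} (hx : IsOfHodgeType d Y k p q (complexBetti.map f k x)) :
    IsOfHodgeType n X k p q x := by
  classical
  obtain ⟨z, hzsum, hz⟩ := A.exists_sum_eq_of_hodgeDecomposition k x
  -- the `f^* z i` are of type `i` in the model `B`
  have hfz : ∀ i ∈ Finset.HasAntidiagonal.antidiagonal k, B.pullback k (complexBetti.map f k (z i)) ∈ B.hodgePQ k i.1 i.2 := by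
    intro i hi
    have h1 : IsOfHodgeType n X k i.1 i.2 (z i) := ⟨A, hz i hi⟩
    obtain ⟨B', hB'⟩ := h1.map_of_independent hI hY hX B f
    exact hI d Y hY B' B k i.1 i.2 _ hB'
  obtain ⟨B', hB'⟩ := hx
  have hxB : B.pullback k (complexBetti.map f k x) ∈ B.hodgePQ k p q := hI d Y hY B' B k p q _ hB'
  by_cases hpq : p + q = k
  swap
  · -- no classes of type `(p, q)` in degree `k ≠ p + q`: `f^* x = 0`, `x = 0`
    have hbot : B.hodgePQ k p q = ⊥ :=
      (B.hodgePQ_eq_bot_iff k p q).2 (Literature.NumberTheory.Transcendental.hodgePQ_eq_bot_of_ne (M := B.carrier) hpq)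
    rw [hbot, Submodule.mem_bot] at hxB
    have h0 : complexBetti.map f k x = 0 := B.pullback_injective k (by rw [hxB, map_zero])
    have hx0 : x = 0 := hf (by rw [h0, map_zero])
    rw [hx0]
    exact IsOfHodgeType.zero A k p q
  -- on the de Rham side of `B` the pieces `H^{a,b}` are independent
  let T : ↥(Finset.HasAntidiagonal.antidiagonal k) → Submodule ℂ (Literature.NumberTheory.Transcendental.complexDeRhamCohomology B.model B.carrier k) :=
    fun i ↦ Literature.NumberTheory.Transcendental.hodgePQ B.model B.carrier k i.1.1 i.1.2
  have hind : iSupIndep T := (B.isInternal_hodgePQ k).submodule_iSupIndep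
  let e := B.deRham B.carrier k
  -- membership in `B.hodgePQ` read on the de Rham side
  have hmem : ∀ {a b : ℕ} {w : singularCohomology ℂ ℂ B.carrier k}, w ∈ B.hodgePQ k a b →
      e.symm w ∈ Literature.NumberTheory.Transcendental.hodgePQ B.model B.carrier k a b := by
    intro a b w hw
    obtain ⟨w₀, hw₀, hww⟩ := Submodule.mem_map.1 hw
    have : e.symm w = w₀ := by rw [← hww]; exact e.symm_apply_apply w₀
    rw [this]
    exact hw₀
  let u : ↥(Finset.HasAntidiagonal.antidiagonal k) → Literature.NumberTheory.Transcendental.complexDeRhamCohomology B.model B.carrier k :=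
    fun i ↦ e.symm (B.pullback k (complexBetti.map f k (z i)))
  have hu : ∀ i, u i ∈ T i := fun i ↦ hmem (hfz i.1 i.2)
  let i₀ : ↥(Finset.HasAntidiagonal.antidiagonal k) := ⟨(p, q), Finset.HasAntidiagonal.mem_antidiagonal.2 hpq⟩
  have hv : e.symm (B.pullback k (complexBetti.map f k x)) ∈ T i₀ := hmem hxB
  have hsum : ∑ i, u i = e.symm (B.pullback k (complexBetti.map f k x)) := by
    change ∑ i : ↥(Finset.HasAntidiagonal.antidiagonal k), e.symm (B.pullback k (complexBetti.map f k (z i))) = _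
    rw [Finset.sum_coe_sort (Finset.HasAntidiagonal.antidiagonal k) (fun i ↦ e.symm (B.pullback k (complexBetti.map f k (z i)))),
      ← map_sum, ← map_sum, ← map_sum, hzsum]
  -- for `i ≠ i₀` the component `u i` lies in `T i` and in `⨆_{j ≠ i} T j`, hence vanishes
  have hui : ∀ i, i ≠ i₀ → u i = 0 := by
    intro i hi
    have h1 : u i = e.symm (B.pullback k (complexBetti.map f k x)) - ∑ j ∈ Finset.univ.erase i, u j := by
      rw [← hsum, ← Finset.add_sum_erase _ _ (Finset.mem_univ i), add_sub_cancel_right]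
    have h2 : u i ∈ ⨆ (j : ↥(Finset.HasAntidiagonal.antidiagonal k)) (_ : j ≠ i), T j := by
      rw [h1]
      refine Submodule.sub_mem _ (Submodule.mem_iSup_of_mem i₀ (Submodule.mem_iSup_of_mem (Ne.symm hi) hv))
        (Submodule.sum_mem _ fun j hj ↦ Submodule.mem_iSup_of_mem j (Submodule.mem_iSup_of_mem (Finset.ne_of_mem_erase hj) (hu j)))
    exact (Submodule.disjoint_def.1 (hind i)) _ (hu i) h2
  -- hence `z i = 0` for `i ≠ (p, q)` and `x = z (p, q)` is of type `(p, q)`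
  have hz0 : ∀ i ∈ Finset.HasAntidiagonal.antidiagonal k, i ≠ (p, q) → z i = 0 := by
    intro i hi hne
    have h1 := hui ⟨i, hi⟩ (fun h ↦ hne (congrArg Subtype.val h))
    have h2 : B.pullback k (complexBetti.map f k (z i)) = 0 := by
      have := congrArg e h1
      rw [map_zero] at this
      rw [← this]
      exact (e.apply_symm_apply _).symm
    have h3 : complexBetti.map f k (z i) = 0 := B.pullback_injective k (by rw [h2, map_zero])
    exact hf (by rw [h3, map_zero])
  have hxz : x = z (p, q) := by
    rw [← hzsum, Finset.sum_eq_single (p, q) (fun i hi hne ↦ hz0 i hi hne)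
      (fun h ↦ (h (Finset.HasAntidiagonal.mem_antidiagonal.2 hpq)).elim)]
  rw [hxz]
  exact ⟨A, hz (p, q) (Finset.HasAntidiagonal.mem_antidiagonal.2 hpq)⟩


end Summit.HodgeConjecture.HodgeConjecture.Theorems

end
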